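import Summits.HodgeConjecture.HodgeConjecture.Theorems.R90S6GLThreePieri         -- ★ W10-f (H.1)(H.2) with the support binders `hS` (p864142)
import Summits.HodgeConjecture.HodgeConjecture.Theorems.R90S6GLThreePieriTables   -- ★ p10 L3 FILE 3: `ncard_pieri_one_eq_zero`, `ncard_pieri_two_eq_zero` (vanishing off the strips) + closed forms
import HarnessLib

/-!
# R90 · S6 «Ch. 14.1–14.5 stable TF» — WAVE 10 card W10-f, CLOSED SEQUEL: THE `GL₃` PIERI RULE WITHOUT BINDERS
# (`Theorems/R90S6GLThreePieriClosed.lean`; row E1.4.4.2.3, GL side; additions-only sequel of ★ `R90S6GLThreePieri`, dealer 01:25:08Z «do NOT reopen this one»)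

Cell `hodgecm-mathlib`, crux H413 (`stmt-HodgeConjecture-24833`), route of record `HCCMUnconditional`; programme R90-TF, section S6 (base `R90-C14`),
seat R90-C14-p06 (g0); junction with R90-C14-p10 (g0) (L3: ★ `R90S6GLPieriCountMaster` p864176 → ★ `R90S6GLThreePieriCounts` → ★ `R90S6GLThreePieriTables`).
This file DISCHARGES the support binders `hS` of ★ (H.1) `doubleCosetOperator_zpowDiagGL_mul_heckeDiag_one_three` and ★ (H.2) `…_two_three` BY NAME from p10's
vanishing theorems, for ANTITONE `μ`:
* **`exists_eq_add_single_of_ncard_pieri_one_ne_zero`** — an antitone `ν` with `N₁(μ, ν) ≠ 0` is `μ + e_i` (★ `ncard_pieri_one_eq_zero`, contrapositive);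
* **`exists_eq_add_one_sub_single_of_ncard_pieri_two_ne_zero`** — an antitone `ν` with `N₂(μ, ν) ≠ 0` is `μ + 𝟙 − e_i` (★ `ncard_pieri_two_eq_zero`, contrapositive,
  re-indexed by the OMITTED row through `μ + e_i + e_j = μ + 𝟙 − e_k`);
* **`doubleCosetOperator_zpowDiagGL_mul_heckeDiag_one_three_of_antitone`**, **`…_two_three_of_antitone`** — (H.1)(H.2) binder-free:
  `c_μ · T₁ = Σ_{i : μ + e_i antitone} N₁(μ, μ + e_i) • c_{μ + e_i}`, `c_μ · T₂ = Σ_{i : μ + 𝟙 − e_i antitone} N₂(μ, μ + 𝟙 − e_i) • c_{μ + 𝟙 − e_i}` (any `CommRing k`).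
The coefficients are p10's ★ closed forms (`ncard_pieri_one_add_single_zero = 1`, `_one = q + [μ₀ = μ₁+1]`, `_two = q² + [μ₁ = μ₂+1]q + [μ₀ = μ₁ = μ₂+1]`,
`ncard_pieri_two_add_single_zero_one = 1`, `_zero_two = q + [μ₁ = μ₂+1]`, `_one_two = q² + [μ₀ = μ₁+1]q + [μ₀ = μ₁+1 ∧ μ₁ = μ₂]`); the fully expanded case tables and the
`b`-images solved for `B_{μ+e₀}` follow in `R90S6BCPartnerRecursionClosed.lean`.  KILL-CHECKS: `T₁·T₁ = c_{(2,0,0)} + (q+1)•c_{(1,1,0)}`, `T₁·T₂ = c_{(2,1,0)} + (q²+q+1)•c_{(1,1,1)}`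
(Macdonald V (2.6), PDF p0164).  Lane `--supports stmt-HodgeConjecture-24833 --as helper`; THEOREMS ONLY.

HONEST LABEL: Hecke-algebra bookkeeping, count-neutral until E1.4.4.2.3 consumes it; HC_CM is proved only modulo the 7 printed citations (2 remaining named inputs:
hLiu418 = stmt-HodgeConjecture-24832, h413 = stmt-HodgeConjecture-24833) until rung 0 closes; REL ≠ ★ ≠ BUILT.

## References
* [Macdonald1995] I. G. Macdonald, *Symmetric Functions and Hall Polynomials*, 2nd ed. (1995), Ch. II (4.2)–(4.6), Ch. V (2.6).
-/

set_option autoImplicit false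
-- the mandated namespace repeats the single-problem summit's segment (`HodgeConjecture.HodgeConjecture`)
set_option linter.dupNamespace false

noncomputable section

open MulAction
open Literature.NumberTheory.Automorphic
open scoped MatrixGroups
open ValuativeRel

namespace Summit.HodgeConjecture.HodgeConjecture.R90.S6

section Closed

universe u

variable {K : Type u} [Field K] [ValuativeRel K] [IsDiscreteValuationRing 𝒪[K]] [Finite 𝓀[K]] {ϖ : K} (hϖ : IsUniformizingElement ϖ)

/-- **SUPPORT, `r = 1`**: an antitone `ν` with `N₁(μ, ν) ≠ 0` is `μ + e_i` (★ p10 `ncard_pieri_one_eq_zero`, contrapositive). [cite: Macdonald1995, Ch. II (4.4)–(4.6)] -/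
theorem exists_eq_add_single_of_ncard_pieri_one_ne_zero {μ : Fin 3 → ℤ} (hμ : Antitone μ) (ν : Fin 3 → ℤ) (hν : Antitone ν)
    (h : ({γ ∈ MulAction.orbit (glInt 3 K) ((heckeDiag 3 (Units.mk0 ϖ hϖ.ne_zero) 1 : GL (Fin 3) K) : GL (Fin 3) K ⧸ glInt 3 K) |
          ((γ.out⁻¹ * zpowDiagGL hϖ.ne_zero ν : GL (Fin 3) K) : GL (Fin 3) K ⧸ glInt 3 K) ∈
            MulAction.orbit (glInt 3 K) ((zpowDiagGL hϖ.ne_zero μ : GL (Fin 3) K) : _ ⧸ _)}).ncard ≠ 0) :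
    ∃ i : Fin 3, ν = μ + Pi.single i 1 := by
  by_contra hne
  push Not at hne
  exact h (ncard_pieri_one_eq_zero hϖ hν hμ (hne 0) (hne 1) (hne 2))

/-- bridge `μ + e_i + e_j = μ + 𝟙 − e_k` for `{i, j, k} = {0, 1, 2}`. [folklore] -/
private theorem add_single_add_single_eq (μ : Fin 3 → ℤ) :
    μ + Pi.single 0 1 + Pi.single 1 1 = μ + 1 - Pi.single 2 1 ∧
    μ + Pi.single 0 1 + Pi.single 2 1 = μ + 1 - Pi.single 1 1 ∧
    μ + Pi.single 1 1 + Pi.single 2 1 = μ + 1 - Pi.single 0 1 := by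
  refine ⟨?_, ?_, ?_⟩ <;> (funext i; fin_cases i <;> simp)

/-- **SUPPORT, `r = 2`**: an antitone `ν` with `N₂(μ, ν) ≠ 0` is `μ + 𝟙 − e_i` (★ p10 `ncard_pieri_two_eq_zero`, contrapositive, re-indexed by the omitted row). [cite: Macdonald1995, Ch. II (4.4)–(4.6)] -/
theorem exists_eq_add_one_sub_single_of_ncard_pieri_two_ne_zero {μ : Fin 3 → ℤ} (hμ : Antitone μ) (ν : Fin 3 → ℤ) (hν : Antitone ν)
    (h : ({γ ∈ MulAction.orbit (glInt 3 K) ((heckeDiag 3 (Units.mk0 ϖ hϖ.ne_zero) 2 : GL (Fin 3) K) : GL (Fin 3) K ⧸ glInt 3 K) |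
          ((γ.out⁻¹ * zpowDiagGL hϖ.ne_zero ν : GL (Fin 3) K) : GL (Fin 3) K ⧸ glInt 3 K) ∈
            MulAction.orbit (glInt 3 K) ((zpowDiagGL hϖ.ne_zero μ : GL (Fin 3) K) : _ ⧸ _)}).ncard ≠ 0) :
    ∃ i : Fin 3, ν = μ + 1 - Pi.single i 1 := by
  by_contra hne
  push Not at hne
  obtain ⟨h01, h02, h12⟩ := add_single_add_single_eq μ
  exact h (ncard_pieri_two_eq_zero hϖ hν hμ (fun e => hne 2 (e.trans h01)) (fun e => hne 1 (e.trans h02)) (fun e => hne 0 (e.trans h12)))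

variable [IsHeckeTriple (⊤ : Submonoid (GL (Fin 3) K)) (glInt 3 K) (glInt 3 K)] {k : Type*} [CommRing k]

/-- **(H.1) CLOSED**: `c_μ · T₁ = Σ_{i : μ + e_i antitone} N₁(μ, μ + e_i) • c_{μ + e_i}` for antitone `μ`, no binder (any `CommRing k`). [cite: Macdonald1995, Ch. II (4.6); Ch. V (2.6)] -/
theorem doubleCosetOperator_zpowDiagGL_mul_heckeDiag_one_three_of_antitone {μ : Fin 3 → ℤ} (hμ : Antitone μ) :
    heckeAlgebra.doubleCosetOperator (k := k) (glInt 3 K) (zpowDiagGL hϖ.ne_zero μ) *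
        heckeAlgebra.doubleCosetOperator (glInt 3 K) (heckeDiag 3 (Units.mk0 ϖ hϖ.ne_zero) 1) =
      ∑ i ∈ Finset.univ.filter (fun i : Fin 3 => Antitone (μ + Pi.single i 1)),
        (({γ ∈ MulAction.orbit (glInt 3 K) ((heckeDiag 3 (Units.mk0 ϖ hϖ.ne_zero) 1 : GL (Fin 3) K) : GL (Fin 3) K ⧸ glInt 3 K) |
            ((γ.out⁻¹ * zpowDiagGL hϖ.ne_zero (μ + Pi.single i 1) : GL (Fin 3) K) : GL (Fin 3) K ⧸ glInt 3 K) ∈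
              MulAction.orbit (glInt 3 K) ((zpowDiagGL hϖ.ne_zero μ : GL (Fin 3) K) : _ ⧸ _)}).ncard : k) •
          heckeAlgebra.doubleCosetOperator (glInt 3 K) (zpowDiagGL hϖ.ne_zero (μ + Pi.single i 1)) :=
  doubleCosetOperator_zpowDiagGL_mul_heckeDiag_one_three hϖ μ (exists_eq_add_single_of_ncard_pieri_one_ne_zero hϖ hμ)

/-- **(H.2) CLOSED**: `c_μ · T₂ = Σ_{i : μ + 𝟙 − e_i antitone} N₂(μ, μ + 𝟙 − e_i) • c_{μ + 𝟙 − e_i}` for antitone `μ`, no binder (any `CommRing k`). [cite: Macdonald1995, Ch. II (4.6); Ch. V (2.6)] -/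
theorem doubleCosetOperator_zpowDiagGL_mul_heckeDiag_two_three_of_antitone {μ : Fin 3 → ℤ} (hμ : Antitone μ) :
    heckeAlgebra.doubleCosetOperator (k := k) (glInt 3 K) (zpowDiagGL hϖ.ne_zero μ) *
        heckeAlgebra.doubleCosetOperator (glInt 3 K) (heckeDiag 3 (Units.mk0 ϖ hϖ.ne_zero) 2) =
      ∑ i ∈ Finset.univ.filter (fun i : Fin 3 => Antitone (μ + 1 - Pi.single i 1)),
        (({γ ∈ MulAction.orbit (glInt 3 K) ((heckeDiag 3 (Units.mk0 ϖ hϖ.ne_zero) 2 : GL (Fin 3) K) : GL (Fin 3) K ⧸ glInt 3 K) |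
            ((γ.out⁻¹ * zpowDiagGL hϖ.ne_zero (μ + 1 - Pi.single i 1) : GL (Fin 3) K) : GL (Fin 3) K ⧸ glInt 3 K) ∈
              MulAction.orbit (glInt 3 K) ((zpowDiagGL hϖ.ne_zero μ : GL (Fin 3) K) : _ ⧸ _)}).ncard : k) •
          heckeAlgebra.doubleCosetOperator (glInt 3 K) (zpowDiagGL hϖ.ne_zero (μ + 1 - Pi.single i 1)) :=
  doubleCosetOperator_zpowDiagGL_mul_heckeDiag_two_three hϖ μ (exists_eq_add_one_sub_single_of_ncard_pieri_two_ne_zero hϖ hμ)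

end Closed

end Summit.HodgeConjecture.HodgeConjecture.R90.S6

end
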